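import Summits.BirchSwinnertonDyer.BirchSwinnertonDyer.Theorems.PrintCf2RubinValueTwoColemanCoinvariantCharSeries
import Literature.NumberTheory.EllipticCurves.PAdicTwoVariableColemanImageCocycleOfUnits
import HarnessLib

/-!
# Brick (c) at `p = 2`, local `χ`-part, FOR FAMILIES OF UNITS in the two-variable frame: from the levelwise relation II §2.4 (ii) among coherent
# tower units `β_𝔠`, **`char_Λ ((N₀ / N′)_ε) = char_Λ (Λ/(L_ε))`** for every `Λ`-submodule `N′` sandwiched between `Λ·{Col β_𝔠}` and
# `φ_ε⁻¹(L_ε·J_ε)` — de Shalit III §1.4 (5) + Cor. 1.5 (7) + Lemma 1.10 (17) at `q = 2`, one prime, over `Λ = 𝒪_F⟦X⟧⟦T⟧`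

Cell `bsd-print-cf2`, width seat `bsd-line-cf2c-w7` g13, route C `PrintCf2RubinValueTwo`, crux of record stmt-BirchSwinnertonDyer-24033
`TwoVariableMainConjAtSplitTwoQuad` (23720 nominal), BRICK §4(c); `--supports` the crux as a helper.  THEOREMS ONLY (0 sorry, no named fact, no
`def … : Prop`); Theses-free.  BSD is not proved by any of this.

Composition of `PrintCf2RubinValueTwoColemanCoinvariantCharSeries` (series side of III §1.4 (5)/(17): `φ_ε(Λ·span x) = L·J_ε`, `Λ/J_ε` pseudo-null,
`char(Λ/(L)·J) = char(Λ/(L))`) with `Literature/…/PAdicTwoVariableColemanImageCocycleOfUnits` (the two-variable Coleman transform `Col` on coherent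
families of units is a homomorphism intertwining `Γ_F`; the levelwise unit relation `(σ̃_𝔠·β_𝔞)·β_𝔠^{N𝔞} = (σ̃_𝔞·β_𝔠)·β_𝔞^{N𝔠}` is the module cocycle;
`∃! L` with `φ_ε(Col β_𝔠) = (t_{χ(σ̃_𝔠)} − N𝔠)·L`):

* §1 (any `(π)`-complete Noetherian domain `S`, `Λ = S⟦T⟧`) ★ `map_colemanDeltaCoinvFun_eq_of_sandwich` — if `φ_ε(x c) = (t_c − N_c)·L` for all `c`,
  then EVERY `Λ`-submodule `N′` with `Λ·span{x c} ≤ N′` and `φ_ε(N′) ≤ (L)·J_ε` has **`φ_ε(N′) = (L)·J_ε`** (`J_ε = (t_c − N_c : c)`); hence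
  ★★ `charIdeal_colemanCoinvariants_eq_of_sandwich`: **`char_Λ ((N₀/N′)_ε) = char_Λ (Λ/(L))`** for `N′ ≤ N₀`, `σ_{−1}N₀ ≤ N₀`, `M/N₀` pseudo-null,
  `L ≠ 0` and the two auxiliary indices (`Λ/J_ε` pseudo-null) — the form in which the closure `Col(𝒞̄)` (between the `Λ`-span of the `Col e(𝔞)` and
  `φ_ε⁻¹` of the closed ideal `L·J_ε`) enters; `…_eq_span_of_sandwich` (`= (L)` over a factorial `Λ`);
* §2 (`S = 𝒪_F⟦X⟧`, `ι = intBase F`, coherent tower families `β : I → coherentFamilies hπ E hmono`, `σ̃_c ∈ Γ_F` fixing `E_∞`, `n : I → ℕ`)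
  ★★★ `charIdeal_colemanCoinvariants_eq_of_units_sandwich` — under the LEVELWISE unit relation, `χ(σ̃_{a₁}) = γ`, `π ∣ n_{a₁} − 1`, an index `a₂`
  with `(t_{χ(σ̃_{a₂})} − n_{a₂})(n_{a₁} − 1) ≠ 0`, and `L ≠ 0` with `φ_ε(Col(β c) j) = (t_{χ(σ̃_c)} − C n_c)·L` (unique: S14), for every sandwiched
  `N′ ≤ N₀`: **`char_Λ ((N₀/N′)_ε) = char_Λ (𝒪_F⟦X⟧⟦T⟧/(L))`**; ★★ `charIdeal_colemanCoinvariants_span_units_eq` (the case `N′ = Λ·span{Col β_c j}`);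
  `…_of_pow` (auxiliary condition `χ(σ̃_{a₂}) = γ^m`, `n_{a₁}^m ≠ n_{a₂}`).

With `β_𝔞 := (e(𝔞)_{𝔓,m})_m` (measure lane's `ellipticUnitsLocal` per level, relation `hrel_ellipticUnitsLocal` at every `m`), `N₀ := Col(𝒰¹_∞)`
(`unitsImage₁`, pseudo-null cokernel: `PrintCf2RubinValueTwoColemanImagePseudoNull`) and `N′ := Col(𝒞̄)` (`colemanImageSubmodule₁`), this is the local
(c)-identity `char (𝒰/𝒞̄)_χ = (μ(𝔣)_χ)` modulo the upper bound `φ_ε(Col 𝒞̄) ≤ L·J_ε` (continuity of `φ_ε` + closedness of ideals of `Λ`).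

## References
* [deShalit1987] E. de Shalit, *Iwasawa theory of elliptic curves with complex multiplication* (1987), II §2.4 (ii), §4.12 (29)–(33); III §1.4 (5),
  Cor. 1.5 (7), Lemma 1.10 (17).
* [Washington1997] L. C. Washington, *Introduction to Cyclotomic Fields* (1997), §13.2.
-/

noncomputable section

set_option linter.dupNamespace false
set_option autoImplicit false

namespace Summit.BirchSwinnertonDyer.BirchSwinnertonDyer.Theorems.PrintCf2.ColemanCoinvariantUnits

open Literature.NumberTheory.EllipticCurves
open Summit.BirchSwinnertonDyer.BirchSwinnertonDyer.Theorems.PrintCf2.SemilocalColeman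
open Summit.BirchSwinnertonDyer.BirchSwinnertonDyer.Theorems.PrintCf2.ColemanCoinvariantSeries

/-! ## §1. The sandwich: any `N′` between `Λ·span x` and `φ_ε⁻¹((L)·J_ε)` -/

section Sandwich

open Literature.NumberTheory.GaloisRepresentations Literature.NumberTheory.GaloisRepresentations.IsNonarchimedeanLocalField
  Literature.NumberTheory.GaloisRepresentations.LubinTate ValuativeRel

variable {F : Type} [Field F] [ValuativeRel F] [TopologicalSpace F] [IsNonarchimedeanLocalField F]

attribute [local instance] ltNormUniformSpace ltNormIsUniformAddGroup rk1 nF nE fintypeResidueField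

variable {π : 𝒪[F]} (hπ : (valuation F).IsUniformizer (π : F)) (hq : residueFieldCard F = 2)
variable {S : Type*} [CommRing S] (ι : LTCoeff F →+* S) [IsAdicComplete (Ideal.span {ι (LTCoeff.of F π)}) S]
variable (u : (LTCoeff F)ˣ) (hu : LTCoeff.of F π = residueFieldCard F * u) (γ : 𝒪[F]ˣ)
variable (hreg : ∀ s : S, ι (LTCoeff.of F π) * s = 0 → s = 0) (w : 𝒪[F]ˣ) (hγ : (γ : 𝒪[F]) = 1 + π ^ 2 * w)
variable (ε : PowerSeries S) (hε : ε * ε = 1)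

/-- ★ **The sandwich**: if `φ_ε(x c) = (t_{v c} − N c)·L` for every `c`, then every `Λ`-submodule `N′` with `Λ·span{x c} ≤ N′` and
`φ_ε(N′) ≤ (L)·J_ε` has `φ_ε(N′) = (L)·J_ε` (`J_ε` the ideal of the `t_{v c} − N c`). [cite: deShalit1987, III §1.4 (5); II §4.12 (33)] -/
theorem map_colemanDeltaCoinvFun_eq_of_sandwich {I : Type*} (x : I → ColemanCoordModule hπ hq ι u hu γ) (v : I → 𝒪[F]ˣ)
    (Nm : I → PowerSeries S) (L : PowerSeries S)
    (hL : ∀ c : I, colemanDeltaCoinvFun hπ hq ι u hu γ hreg w hγ ε (x c) =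
      (colemanDeltaCoinvFun hπ hq ι u hu γ hreg w hγ ε (unitTwistₗ hπ hq ι u hu γ (v c) (TActModule.ofPS _ _ 1)) - Nm c) * L)
    (N' : Submodule (PowerSeries S) (ColemanCoordModule hπ hq ι u hu γ)) (hxN' : Submodule.span (PowerSeries S) (Set.range x) ≤ N')
    (hN'L : N'.map (colemanDeltaCoinvFun hπ hq ι u hu γ hreg w hγ ε) ≤ Ideal.span {L} * Ideal.span (Set.range fun c =>
      colemanDeltaCoinvFun hπ hq ι u hu γ hreg w hγ ε (unitTwistₗ hπ hq ι u hu γ (v c) (TActModule.ofPS _ _ 1)) - Nm c)) :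
    N'.map (colemanDeltaCoinvFun hπ hq ι u hu γ hreg w hγ ε) = Ideal.span {L} * Ideal.span (Set.range fun c =>
      colemanDeltaCoinvFun hπ hq ι u hu γ hreg w hγ ε (unitTwistₗ hπ hq ι u hu γ (v c) (TActModule.ofPS _ _ 1)) - Nm c) := by
  refine le_antisymm hN'L ?_
  rw [← span_range_mul_eq_span_singleton_mul, ← colemanDeltaCoinvFun_map_span_range_eq_span_mul_of_forall hπ hq ι u hu γ hreg w hγ ε x v Nm L hL]
  exact Submodule.map_mono hxN'

variable [IsDomain S] [IsNoetherianRing S]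

include hε in
/-- ★★ **`char_Λ ((N₀/N′)_ε) = char_Λ (Λ/(L))` for every sandwiched `N′`**: `Λ·span{x c} ≤ N′ ≤ N₀`, `φ_ε(N′) ≤ (L)·J_ε`, `σ_{−1}N₀ ≤ N₀`, `M/N₀`
pseudo-null, `L ≠ 0`, and the two auxiliary indices (`v a₁ = γ`, `N a₁ = C n₁`, `n₁ ≡ 1 (π)`; `(t_{v a₂} − N a₂)(n₁ − 1) ≠ 0`) making `Λ/J_ε` pseudo-null.
[cite: deShalit1987, III §1.4 (5), Cor. 1.5 (7), Lemma 1.10 (17)] [cite: Washington1997, §13.2] -/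
theorem charIdeal_colemanCoinvariants_eq_of_sandwich {I : Type*} (x : I → ColemanCoordModule hπ hq ι u hu γ) (v : I → 𝒪[F]ˣ)
    (Nm : I → PowerSeries S) (a₁ a₂ : I) (hv₁ : v a₁ = γ) {n₁ : S} (hN₁ : Nm a₁ = PowerSeries.C n₁)
    (hn₁ : n₁ - 1 ∈ Ideal.span {ι (LTCoeff.of F π)})
    (ha₂ : tEval hn₁ (colemanDeltaCoinvFun hπ hq ι u hu γ hreg w hγ ε
        (unitTwistₗ hπ hq ι u hu γ (v a₂) (TActModule.ofPS _ _ 1)) - Nm a₂) ≠ 0)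
    (L : PowerSeries S) (hL0 : L ≠ 0)
    (hL : ∀ c : I, colemanDeltaCoinvFun hπ hq ι u hu γ hreg w hγ ε (x c) =
      (colemanDeltaCoinvFun hπ hq ι u hu γ hreg w hγ ε (unitTwistₗ hπ hq ι u hu γ (v c) (TActModule.ofPS _ _ 1)) - Nm c) * L)
    (N' N₀ : Submodule (PowerSeries S) (ColemanCoordModule hπ hq ι u hu γ)) (hxN' : Submodule.span (PowerSeries S) (Set.range x) ≤ N')
    (hN'L : N'.map (colemanDeltaCoinvFun hπ hq ι u hu γ hreg w hγ ε) ≤ Ideal.span {L} * Ideal.span (Set.range fun c =>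
      colemanDeltaCoinvFun hπ hq ι u hu γ hreg w hγ ε (unitTwistₗ hπ hq ι u hu γ (v c) (TActModule.ofPS _ _ 1)) - Nm c))
    (hN'N₀ : N' ≤ N₀) (hN₀ : ∀ n ∈ N₀, unitTwistₗ hπ hq ι u hu γ (-1) n ∈ N₀)
    (hMN₀ : Module.IsPseudoNull (PowerSeries S) (ColemanCoordModule hπ hq ι u hu γ ⧸ N₀)) :
    Module.charIdeal (PowerSeries S) (N₀ ⧸ colemanCoinvRel hπ hq ι u hu γ ε N₀ hN₀ N') =
      Module.charIdeal (PowerSeries S) (PowerSeries S ⧸ Ideal.span {L}) := by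
  rw [charIdeal_colemanCoinvariants_eq hπ hq ι u hu γ hreg w hγ ε hε N₀ hN₀ N' hN'N₀ hMN₀]
  have hmap := map_colemanDeltaCoinvFun_eq_of_sandwich hπ hq ι u hu γ hreg w hγ ε x v Nm L hL N' hxN' hN'L
  have e : (PowerSeries S ⧸ N'.map (colemanDeltaCoinvFun hπ hq ι u hu γ hreg w hγ ε)) ≃ₗ[PowerSeries S]
      (PowerSeries S ⧸ Ideal.span {L} * Ideal.span (Set.range fun c =>
        colemanDeltaCoinvFun hπ hq ι u hu γ hreg w hγ ε (unitTwistₗ hπ hq ι u hu γ (v c) (TActModule.ofPS _ _ 1)) - Nm c)) :=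
    Submodule.quotEquivOfEq _ _ hmap
  rw [charIdeal_eq_of_linearEquiv e]
  refine charIdeal_quotient_span_singleton_mul_eq hL0 (isPseudoNull_quotient_of_X_sub_C_mem hn₁ ?_ (Ideal.subset_span ⟨a₂, rfl⟩) ha₂)
  have e₁ : colemanDeltaCoinvFun hπ hq ι u hu γ hreg w hγ ε (unitTwistₗ hπ hq ι u hu γ (v a₁) (TActModule.ofPS _ _ 1)) - Nm a₁ =
      PowerSeries.X - PowerSeries.C (n₁ - 1) := by
    rw [hv₁, hN₁, colemanDeltaCoinvFun_unitTwistₗ_self_one_sub_C, one_mul]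
  rw [← e₁]
  exact Ideal.subset_span ⟨a₁, rfl⟩

include hε in
/-- **Factorial base**: `char_Λ ((N₀/N′)_ε) = (L)` for every sandwiched `N′`. [cite: deShalit1987, III Cor. 1.5 (7), Lemma 1.10 (17)] -/
theorem charIdeal_colemanCoinvariants_eq_span_of_sandwich [UniqueFactorizationMonoid (PowerSeries S)] {I : Type*}
    (x : I → ColemanCoordModule hπ hq ι u hu γ) (v : I → 𝒪[F]ˣ)
    (Nm : I → PowerSeries S) (a₁ a₂ : I) (hv₁ : v a₁ = γ) {n₁ : S} (hN₁ : Nm a₁ = PowerSeries.C n₁)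
    (hn₁ : n₁ - 1 ∈ Ideal.span {ι (LTCoeff.of F π)})
    (ha₂ : tEval hn₁ (colemanDeltaCoinvFun hπ hq ι u hu γ hreg w hγ ε
        (unitTwistₗ hπ hq ι u hu γ (v a₂) (TActModule.ofPS _ _ 1)) - Nm a₂) ≠ 0)
    (L : PowerSeries S) (hL0 : L ≠ 0)
    (hL : ∀ c : I, colemanDeltaCoinvFun hπ hq ι u hu γ hreg w hγ ε (x c) =
      (colemanDeltaCoinvFun hπ hq ι u hu γ hreg w hγ ε (unitTwistₗ hπ hq ι u hu γ (v c) (TActModule.ofPS _ _ 1)) - Nm c) * L)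
    (N' N₀ : Submodule (PowerSeries S) (ColemanCoordModule hπ hq ι u hu γ)) (hxN' : Submodule.span (PowerSeries S) (Set.range x) ≤ N')
    (hN'L : N'.map (colemanDeltaCoinvFun hπ hq ι u hu γ hreg w hγ ε) ≤ Ideal.span {L} * Ideal.span (Set.range fun c =>
      colemanDeltaCoinvFun hπ hq ι u hu γ hreg w hγ ε (unitTwistₗ hπ hq ι u hu γ (v c) (TActModule.ofPS _ _ 1)) - Nm c))
    (hN'N₀ : N' ≤ N₀) (hN₀ : ∀ n ∈ N₀, unitTwistₗ hπ hq ι u hu γ (-1) n ∈ N₀)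
    (hMN₀ : Module.IsPseudoNull (PowerSeries S) (ColemanCoordModule hπ hq ι u hu γ ⧸ N₀)) :
    Module.charIdeal (PowerSeries S) (N₀ ⧸ colemanCoinvRel hπ hq ι u hu γ ε N₀ hN₀ N') = Ideal.span {L} := by
  rw [charIdeal_colemanCoinvariants_eq_of_sandwich hπ hq ι u hu γ hreg w hγ ε hε x v Nm a₁ a₂ hv₁ hN₁ hn₁ ha₂ L hL0 hL N' N₀ hxN' hN'L hN'N₀
    hN₀ hMN₀, Module.charIdeal_quotient_span_singleton hL0]

end Sandwich

/-! ## §2. Two-variable families of units -/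

section Units

open Literature.NumberTheory.GaloisRepresentations Literature.NumberTheory.GaloisRepresentations.IsNonarchimedeanLocalField
  Literature.NumberTheory.GaloisRepresentations.LubinTate ValuativeRel Field

variable {F : Type} [Field F] [ValuativeRel F] [TopologicalSpace F] [IsNonarchimedeanLocalField F]

attribute [local instance] ltNormUniformSpace ltNormIsUniformAddGroup rk1 nF nE fintypeResidueField
attribute [local instance] RelNormCoherentUnits.instCommMonoid

variable {p : ℕ} [hp : Fact p.Prime] {d : ℕ} (hd : d.Coprime p)
variable {π : 𝒪[F]} (hπ : (valuation F).IsUniformizer (π : F))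
variable (E : ℕ → IntermediateField F (AlgebraicClosure F)) [∀ m, FiniteDimensional F (E m)] [∀ m, Normal F (E m)]
  [∀ m, IsGalois F (E m)] (hmono : Monotone E) (hE : ∀ m, E m ≤ maxUnramified F) (hdeg : ∀ m, Module.finrank F (E m) = d * p ^ m)
  {σ₀ : absoluteGaloisGroup F} (hσ₀ : IsAbsArithFrob σ₀) (hq : residueFieldCard F = 2)
variable (u : (LTCoeff F)ˣ) (hu : LTCoeff.of F π = residueFieldCard F * u) (γ : 𝒪[F]ˣ)
variable [NeZero d] [IsAdicComplete (Ideal.span {(p : 𝒪[F])}) 𝒪[F]]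
variable {θ : ∀ m, unitBall (E m)} (hθ : ∀ m, IsIntegralNormalGen (E m) (θ m))
  (hcoh : ∀ m, unitBallTrace (hmono (Nat.le_succ m)) (θ (m + 1)) = θ m)
variable [IsAdicComplete (Ideal.span {intBase F (LTCoeff.of F π)}) (PowerSeries 𝒪[F])]
variable (w : 𝒪[F]ˣ) (hγ : (γ : 𝒪[F]) = 1 + π ^ 2 * w) (ε : PowerSeries (PowerSeries 𝒪[F])) (hε : ε * ε = 1)

include hdeg hε in
/-- ★★★ **THE LOCAL (c)-IDENTITY FOR FAMILIES OF UNITS, two-variable frame, `ε`-part, one prime, `q = 2`**: let the coherent tower families `β_c`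
satisfy the levelwise relation `(σ̃_c·β_{a,m})·β_{c,m}^{n_a} = (σ̃_a·β_{c,m})·β_{a,m}^{n_c}` (II §2.4 (ii)), `χ(σ̃_{a₁}) = γ`, `π ∣ n_{a₁} − 1`, an index `a₂` with
`(t_{χ(σ̃_{a₂})} − n_{a₂})(n_{a₁} − 1) ≠ 0`, and let `L ≠ 0` satisfy `φ_ε(Col(β c) j) = (t_{χ(σ̃_c)} − C n_c)·L` for all `c` (it exists uniquely:
`existsUnique_colemanDeltaCoinvFun_colemanImageCoh_eq_mul`).  Then for every `Λ`-submodule `N′` with `Λ·span{Col(β c) j} ≤ N′ ≤ N₀`, `φ_ε(N′) ≤ (L)·J_ε`,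
`σ_{−1}N₀ ≤ N₀`, `M/N₀` pseudo-null: **`char_Λ ((N₀/N′)_ε) = char_Λ (𝒪_F⟦X⟧⟦T⟧ ⧸ (L))`.** [cite: deShalit1987, III §1.4 (5), Cor. 1.5 (7), Lemma 1.10 (17); II §4.12]
[cite: Washington1997, §13.2] -/
theorem charIdeal_colemanCoinvariants_eq_of_units_sandwich {I : Type*} (β : I → coherentFamilies hπ E hmono)
    (σ : I → absoluteGaloisGroup F) (n : I → ℕ) (a₁ a₂ : I) (hv₁ : lubinTateChar hπ (σ a₁) = γ) (hn₁ : (π : 𝒪[F]) ∣ (n a₁ : 𝒪[F]) - 1)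
    (ha₂ : tEval (natCast_sub_one_mem_span_intBase (F := F) hn₁)
      (colemanDeltaCoinvFun hπ hq (intBase F) u hu γ (eq_zero_of_C_pi_mul_eq_zero_integer hπ) w hγ ε
          (unitTwistₗ hπ hq (intBase F) u hu γ (lubinTateChar hπ (σ a₂)) (TActModule.ofPS _ _ 1)) -
        PowerSeries.C ((n a₂ : ℕ) : PowerSeries 𝒪[F])) ≠ 0) (j : ZMod d)
    (L : PowerSeries (PowerSeries 𝒪[F])) (hL0 : L ≠ 0)
    (hL : ∀ c : I, colemanDeltaCoinvFun hπ hq (intBase F) u hu γ (eq_zero_of_C_pi_mul_eq_zero_integer hπ) w hγ ε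
        (colemanImageCoh hd hπ E hmono hE hdeg hσ₀ hq u hu γ hθ hcoh (β c) j) =
      (colemanDeltaCoinvFun hπ hq (intBase F) u hu γ (eq_zero_of_C_pi_mul_eq_zero_integer hπ) w hγ ε
          (unitTwistₗ hπ hq (intBase F) u hu γ (lubinTateChar hπ (σ c)) (TActModule.ofPS _ _ 1)) -
        PowerSeries.C ((n c : ℕ) : PowerSeries 𝒪[F])) * L)
    (N' N₀ : Submodule (PowerSeries (PowerSeries 𝒪[F])) (ColemanCoordModule hπ hq (intBase F) u hu γ))
    (hxN' : ∀ c, colemanImageCoh hd hπ E hmono hE hdeg hσ₀ hq u hu γ hθ hcoh (β c) j ∈ N')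
    (hN'L : N'.map (colemanDeltaCoinvFun hπ hq (intBase F) u hu γ (eq_zero_of_C_pi_mul_eq_zero_integer hπ) w hγ ε) ≤
      Ideal.span {L} * Ideal.span (Set.range fun c =>
        colemanDeltaCoinvFun hπ hq (intBase F) u hu γ (eq_zero_of_C_pi_mul_eq_zero_integer hπ) w hγ ε
            (unitTwistₗ hπ hq (intBase F) u hu γ (lubinTateChar hπ (σ c)) (TActModule.ofPS _ _ 1)) -
          PowerSeries.C ((n c : ℕ) : PowerSeries 𝒪[F])))
    (hN'N₀ : N' ≤ N₀) (hN₀ : ∀ x ∈ N₀, unitTwistₗ hπ hq (intBase F) u hu γ (-1) x ∈ N₀)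
    (hMN₀ : Module.IsPseudoNull (PowerSeries (PowerSeries 𝒪[F])) (ColemanCoordModule hπ hq (intBase F) u hu γ ⧸ N₀)) :
    Module.charIdeal (PowerSeries (PowerSeries 𝒪[F])) (N₀ ⧸ colemanCoinvRel hπ hq (intBase F) u hu γ ε N₀ hN₀ N') =
      Module.charIdeal (PowerSeries (PowerSeries 𝒪[F])) (PowerSeries (PowerSeries 𝒪[F]) ⧸ Ideal.span {L}) :=
  charIdeal_colemanCoinvariants_eq_of_sandwich hπ hq (intBase F) u hu γ (eq_zero_of_C_pi_mul_eq_zero_integer hπ) w hγ ε hε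
    (fun c => colemanImageCoh hd hπ E hmono hE hdeg hσ₀ hq u hu γ hθ hcoh (β c) j) (fun c => lubinTateChar hπ (σ c))
    (fun c => PowerSeries.C ((n c : ℕ) : PowerSeries 𝒪[F])) a₁ a₂ hv₁ rfl (natCast_sub_one_mem_span_intBase (F := F) hn₁) ha₂ L hL0 hL
    N' N₀ (Submodule.span_le.mpr (Set.range_subset_iff.mpr hxN')) hN'L hN'N₀ hN₀ hMN₀

include hdeg hε in
/-- ★★ **The case `N′ = Λ·span{Col(β c) j}`** (no upper-bound hypothesis): `char_Λ ((N₀ / Λ·span{Col β_c j})_ε) = char_Λ (Λ/(L))`.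
[cite: deShalit1987, III §1.4 (5), Cor. 1.5 (7), Lemma 1.10 (17)] [cite: Washington1997, §13.2] -/
theorem charIdeal_colemanCoinvariants_span_units_eq {I : Type*} (β : I → coherentFamilies hπ E hmono)
    (σ : I → absoluteGaloisGroup F) (n : I → ℕ) (a₁ a₂ : I) (hv₁ : lubinTateChar hπ (σ a₁) = γ) (hn₁ : (π : 𝒪[F]) ∣ (n a₁ : 𝒪[F]) - 1)
    (ha₂ : tEval (natCast_sub_one_mem_span_intBase (F := F) hn₁)
      (colemanDeltaCoinvFun hπ hq (intBase F) u hu γ (eq_zero_of_C_pi_mul_eq_zero_integer hπ) w hγ ε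
          (unitTwistₗ hπ hq (intBase F) u hu γ (lubinTateChar hπ (σ a₂)) (TActModule.ofPS _ _ 1)) -
        PowerSeries.C ((n a₂ : ℕ) : PowerSeries 𝒪[F])) ≠ 0) (j : ZMod d)
    (L : PowerSeries (PowerSeries 𝒪[F])) (hL0 : L ≠ 0)
    (hL : ∀ c : I, colemanDeltaCoinvFun hπ hq (intBase F) u hu γ (eq_zero_of_C_pi_mul_eq_zero_integer hπ) w hγ ε
        (colemanImageCoh hd hπ E hmono hE hdeg hσ₀ hq u hu γ hθ hcoh (β c) j) =
      (colemanDeltaCoinvFun hπ hq (intBase F) u hu γ (eq_zero_of_C_pi_mul_eq_zero_integer hπ) w hγ ε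
          (unitTwistₗ hπ hq (intBase F) u hu γ (lubinTateChar hπ (σ c)) (TActModule.ofPS _ _ 1)) -
        PowerSeries.C ((n c : ℕ) : PowerSeries 𝒪[F])) * L)
    (N₀ : Submodule (PowerSeries (PowerSeries 𝒪[F])) (ColemanCoordModule hπ hq (intBase F) u hu γ))
    (hxN₀ : ∀ c, colemanImageCoh hd hπ E hmono hE hdeg hσ₀ hq u hu γ hθ hcoh (β c) j ∈ N₀)
    (hN₀ : ∀ x ∈ N₀, unitTwistₗ hπ hq (intBase F) u hu γ (-1) x ∈ N₀)
    (hMN₀ : Module.IsPseudoNull (PowerSeries (PowerSeries 𝒪[F])) (ColemanCoordModule hπ hq (intBase F) u hu γ ⧸ N₀)) :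
    Module.charIdeal (PowerSeries (PowerSeries 𝒪[F])) (N₀ ⧸ colemanCoinvRel hπ hq (intBase F) u hu γ ε N₀ hN₀
        (Submodule.span (PowerSeries (PowerSeries 𝒪[F]))
          (Set.range fun c => colemanImageCoh hd hπ E hmono hE hdeg hσ₀ hq u hu γ hθ hcoh (β c) j))) =
      Module.charIdeal (PowerSeries (PowerSeries 𝒪[F])) (PowerSeries (PowerSeries 𝒪[F]) ⧸ Ideal.span {L}) :=
  charIdeal_colemanCoinvariants_span_eq hπ hq (intBase F) u hu γ (eq_zero_of_C_pi_mul_eq_zero_integer hπ) w hγ ε hε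
    (fun c => colemanImageCoh hd hπ E hmono hE hdeg hσ₀ hq u hu γ hθ hcoh (β c) j) (fun c => lubinTateChar hπ (σ c))
    (fun c => PowerSeries.C ((n c : ℕ) : PowerSeries 𝒪[F])) a₁ a₂ hv₁ rfl (natCast_sub_one_mem_span_intBase (F := F) hn₁) ha₂ L hL0 hL
    N₀ hN₀ (Submodule.span_le.mpr (Set.range_subset_iff.mpr hxN₀)) hMN₀

include hdeg hε in
/-- **Existence packaging**: under the levelwise unit relation (with `σ̃_c` fixing `E_∞`) and the two auxiliary indices, THE series `L` exists
(uniquely) and — if non-zero — computes `char_Λ ((N₀ / Λ·span{Col β_c j})_ε) = char_Λ (Λ/(L))`. [cite: deShalit1987, II §4.12 (33); III §1.4 (5), Lemma 1.10 (17)] -/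
theorem exists_charIdeal_colemanCoinvariants_span_units_eq {I : Type*} (β : I → coherentFamilies hπ E hmono)
    (σ : I → absoluteGaloisGroup F) (hσE : ∀ (i : I) (m : ℕ) (x : E m), σ i • (x : AlgebraicClosure F) = x) (n : I → ℕ)
    (hrel : ∀ (a c : I) (m : ℕ), ((β a).1 m).galAct (σ c) * (β c).1 m ^ n a = ((β c).1 m).galAct (σ a) * (β a).1 m ^ n c)
    (a₁ a₂ : I) (hv₁ : lubinTateChar hπ (σ a₁) = γ) (hn₁ : (π : 𝒪[F]) ∣ (n a₁ : 𝒪[F]) - 1)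
    (ha₂ : tEval (natCast_sub_one_mem_span_intBase (F := F) hn₁)
      (colemanDeltaCoinvFun hπ hq (intBase F) u hu γ (eq_zero_of_C_pi_mul_eq_zero_integer hπ) w hγ ε
          (unitTwistₗ hπ hq (intBase F) u hu γ (lubinTateChar hπ (σ a₂)) (TActModule.ofPS _ _ 1)) -
        PowerSeries.C ((n a₂ : ℕ) : PowerSeries 𝒪[F])) ≠ 0) (j : ZMod d)
    (N₀ : Submodule (PowerSeries (PowerSeries 𝒪[F])) (ColemanCoordModule hπ hq (intBase F) u hu γ))
    (hxN₀ : ∀ c, colemanImageCoh hd hπ E hmono hE hdeg hσ₀ hq u hu γ hθ hcoh (β c) j ∈ N₀)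
    (hN₀ : ∀ x ∈ N₀, unitTwistₗ hπ hq (intBase F) u hu γ (-1) x ∈ N₀)
    (hMN₀ : Module.IsPseudoNull (PowerSeries (PowerSeries 𝒪[F])) (ColemanCoordModule hπ hq (intBase F) u hu γ ⧸ N₀)) :
    ∃ L : PowerSeries (PowerSeries 𝒪[F]),
      (∀ c : I, colemanDeltaCoinvFun hπ hq (intBase F) u hu γ (eq_zero_of_C_pi_mul_eq_zero_integer hπ) w hγ ε
          (colemanImageCoh hd hπ E hmono hE hdeg hσ₀ hq u hu γ hθ hcoh (β c) j) =
        (colemanDeltaCoinvFun hπ hq (intBase F) u hu γ (eq_zero_of_C_pi_mul_eq_zero_integer hπ) w hγ ε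
            (unitTwistₗ hπ hq (intBase F) u hu γ (lubinTateChar hπ (σ c)) (TActModule.ofPS _ _ 1)) -
          PowerSeries.C ((n c : ℕ) : PowerSeries 𝒪[F])) * L) ∧
      (L ≠ 0 → Module.charIdeal (PowerSeries (PowerSeries 𝒪[F])) (N₀ ⧸ colemanCoinvRel hπ hq (intBase F) u hu γ ε N₀ hN₀
          (Submodule.span (PowerSeries (PowerSeries 𝒪[F]))
            (Set.range fun c => colemanImageCoh hd hπ E hmono hE hdeg hσ₀ hq u hu γ hθ hcoh (β c) j))) =
        Module.charIdeal (PowerSeries (PowerSeries 𝒪[F])) (PowerSeries (PowerSeries 𝒪[F]) ⧸ Ideal.span {L})) := by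
  obtain ⟨L, hL, -⟩ := existsUnique_colemanDeltaCoinvFun_colemanImageCoh_eq_mul hd hπ E hmono hE hdeg hσ₀ hq u hu γ hθ hcoh w hγ ε hε β σ hσE
    n hrel a₁ a₂ hv₁ hn₁ ha₂ j
  exact ⟨L, hL, fun hL0 => charIdeal_colemanCoinvariants_span_units_eq hd hπ E hmono hE hdeg hσ₀ hq u hu γ hθ hcoh w hγ ε hε β σ n a₁ a₂ hv₁
    hn₁ ha₂ j L hL0 hL N₀ hxN₀ hN₀ hMN₀⟩

end Units

end Summit.BirchSwinnertonDyer.BirchSwinnertonDyer.Theorems.PrintCf2.ColemanCoinvariantUnits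

end
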